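import Summits.BirchSwinnertonDyer.BirchSwinnertonDyer.Theorems.Rank2ObservatoryRank3ParityBSDPrediction
import Literature.NumberTheory.EllipticCurves.Curve5077aRootNumber
import Literature.NumberTheory.EllipticCurves.Curve5077aAnalyticRank
import HarnessLib

/-!
# BirchSwinnertonDyer — rank ≥ 2 observatory: rank-3 census, ROW 0 (`5077a1`) ENTIRELY BY NAME — the engine-side sign hypotheses discharged by the Modularity Theorem, `rank_ℤ = 3` hypothesis-free

HONEST FRAMING: per-curve certified theorems and census instruments; no claim on BSD in rank ≥ 2.
ONE curve; every statement below is known in print (Buhler–Gross–Zagier 1985, Gross–Zagier 1986,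
Kolyvagin 1990, Cremona's two-descent); nothing general about BSD is claimed or follows.

Pure glue BY NAME (no definitions, no data, no numerics, no engine-side input) joining two finished
pieces of the tree at the census's first row:
* CENSUS SIDE. Row `0` of `rank3Table` IS Buhler–Gross–Zagier's curve — `rank3Table_row0_eq` and
  `curve_row0_eq : (rank3Table[0]).curve = Curve5077a.E` (both `rfl`); its label `5077a1` is not one of
  the 112 residual labels (`decide`), so **`rank_ℤ E(ℚ) = 3` EXACTLY with NO hypothesis** by the
  kernel-checked 2-descent certificate (`Rank3CensusAudit.rank_eq_three_of_label_not_mem112`) —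
  transported to the Literature curve as `curve5077a_mordellWeilRank_eq_three` (the Literature file
  `Curve5077aRank` has `3 ≤ rank_ℤ` only: three independent points).
* LITERATURE SIDE. `Curve5077a.rootNumber_E (hmod) : w(E) = −1` — the global root number COMPUTED in the
  tree from the Modularity Theorem (`exists_isNewformOf`; squarefree conductor `5077`, Atkin–Lehner), and
  `Curve5077a.three_le_analyticRank (hGZK) (hw)`.
CONSEQUENCES for row `0` (§2–§3), with the census headlines' engine-side hypotheses `hKD`/`hR` (certified
Kronecker/sign data) REPLACED by the Modularity Theorem and `hrank` by the certificate:
parity `w(E) = (−1)^{rank_ℤ}` and `rank_ℤ ≡ ord (mod 2)` modulo Modularity ALONE (no Gross–Zagier, no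
engine); `3 = rank_ℤ ≤ ord_{s=1} L(E,s)` modulo Modularity + GZK; BSD's prediction `L‴(E,1) ≠ 0` modulo
Modularity; «weak BSD for `5077a1` ↔ `L‴(E,1) ≠ 0`» (→ Modularity, ← + GZK); a failure at this row would force
`ord ≥ 5`. NOT in this file: the discharge of `L‴(E,1) ≠ 0` itself — it IS a theorem of the tree
(`Curve5077aAnalyticRankLeThree.iteratedDeriv_three_entireLFunction_E_ne_zero (hmod) (hGZK)`, numerics-free
via the kernel certificate `bgzSum_pos`), but that module's hub olean is absent at the time of writing; the
one-line join `weakBSD_row0 : ord = rank_ℤ` is staged in the cell for filing once it is rebuilt.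

References: J. P. Buhler, B. H. Gross, D. B. Zagier, Math. Comp. 44 (1985) 473–481, §1, §4 (11), (14);
B. H. Gross, D. B. Zagier, Invent. Math. 84 (1986) 225–320, (8.2)–(8.3); H. Darmon, *Rational Points
on Modular Elliptic Curves* (2004), Thm. 3.22 (Gross–Zagier–Kolyvagin); J. E. Cremona, *Algorithms for Modular Elliptic Curves* (2nd ed. 1997), §3.5–§3.6 and the
electronic tables `ecdata` (5077a1); T. & V. Dokchitser, Ann. of Math. 172 (2010), §1 Conj. 1.1;
A. Wiles, Clay problem description (2000), p. 2.
-/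

-- single-conjunct summit: `Summit.BirchSwinnertonDyer.BirchSwinnertonDyer.…` repeats the name by design
set_option linter.dupNamespace false

namespace Summit.BirchSwinnertonDyer.BirchSwinnertonDyer.Rank2Observatory

open Literature Literature.NumberTheory.EllipticCurves Literature.NumberTheory.EllipticCurves.ModularForms
open WeierstrassCurve
open Rank3CensusAudit (residualLabels112 rank_eq_three_of_label_not_mem112)

/-! ### §1 Row `0` of the census is Buhler–Gross–Zagier's curve; `rank_ℤ = 3` hypothesis-free -/

/-- Row `0` of `rank3Table` is the data row of `5077a1` (definitional unfolding of the head of the table).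
[cite: CremonaAlgorithms1997, Tables] [cite: BuhlerGrossZagier1985, §1 (p. 473)] -/
theorem rank3Table_row0_eq : rank3Table[0]'(by rw [rank3Table_length]; decide) =
    ⟨"5077a1", 0, 0, 1, -7, 6, 5077, -7, 4792, (1, 0, 1), (2, 0, 1), (0, 2, 1)⟩ := rfl

/-- The curve of row `0` IS the Literature curve `Curve5077a.E : y² + y = x³ − 7x + 6` (`rfl`).
[cite: BuhlerGrossZagier1985, §1 (p. 473)] -/
theorem curve_row0_eq : (rank3Table[0]'(by rw [rank3Table_length]; decide)).curve = Curve5077a.E := rfl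

/-- The label of row `0` is not one of the 112 residual labels (kernel `decide`). [cite: CremonaAlgorithms1997, Tables] -/
theorem label_row0_not_mem_residualLabels112 :
    (rank3Table[0]'(by rw [rank3Table_length]; decide)).label ∉ residualLabels112 := by decide

/-- **`rank_ℤ E(ℚ) = 3` EXACTLY for row `0`, with NO hypothesis** (the census's kernel-checked 2-descent
certificate, via the label form of the residual-112 audit). [cite: CremonaAlgorithms1997, Tables, §3.5, §3.6] -/
theorem mordellWeilRank_row0_eq_three :
    (rank3Table[0]'(by rw [rank3Table_length]; decide)).curve.mordellWeilRank = 3 :=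
  rank_eq_three_of_label_not_mem112 (List.getElem_mem _) label_row0_not_mem_residualLabels112

/-- **`rank_ℤ 5077a(ℚ) = 3` exactly, for the Literature curve `Curve5077a.E`, hypothesis-free** — the
Literature file has `3 ≤ rank_ℤ` (three independent points, `Curve5077a.three_le_mordellWeilRank`); the
equality is the census's 2-descent certificate transported along `curve_row0_eq`.
[cite: CremonaAlgorithms1997, Tables, §3.5, §3.6] [cite: BuhlerGrossZagier1985, §2 p. 475] -/
theorem curve5077a_mordellWeilRank_eq_three : Curve5077a.E.mordellWeilRank = 3 := by
  rw [← curve_row0_eq]; exact mordellWeilRank_row0_eq_three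

/-! ### §2 The Modularity Theorem discharges the engine-side sign hypotheses of row `0` -/

/-- Row `0`: `w(E) = −1` from the Modularity Theorem ALONE (`Curve5077a.rootNumber_E`: the root number of
the squarefree-conductor curve computed in the tree) — replaces the census headlines' certified-data
hypotheses `hKD`/`hR` for this row. [cite: BuhlerGrossZagier1985, §4 (11)] [cite: GrossZagier1986, (8.2)–(8.3)] -/
theorem rootNumber_row0_eq_neg_one (hmod : exists_isNewformOf) :
    (rank3Table[0]'(by rw [rank3Table_length]; decide)).curve.rootNumber = -1 := by
  rw [curve_row0_eq]; exact Curve5077a.rootNumber_E hmod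

/-- **Parity for `5077a`, sign form, modulo Modularity ALONE** (no Gross–Zagier, no engine-side input):
`w(E) = (−1)^{rank_ℤ E(ℚ)}`. [cite: DokchitserDokchitser2010, §1 Conj. 1.1 and Thm. 1.4]
[cite: BuhlerGrossZagier1985, §4 (11)] -/
theorem curve5077a_rootNumber_eq_neg_one_pow_rank (hmod : exists_isNewformOf) :
    Curve5077a.E.rootNumber = (-1) ^ Curve5077a.E.mordellWeilRank :=
  rootNumber_eq_neg_one_pow_rank_of_rank_eq_three _ curve5077a_mordellWeilRank_eq_three
    (Curve5077a.rootNumber_E hmod)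

/-- **Parity for `5077a`, order form, modulo Modularity ALONE**: `rank_ℤ E(ℚ)` is even iff
`ord_{s=1} L(E,s)` is even (both are odd). [cite: DokchitserDokchitser2010, §1 Conj. 1.1 and Thm. 1.4] -/
theorem curve5077a_even_rank_iff_even_analyticRank (hmod : exists_isNewformOf) :
    Even Curve5077a.E.mordellWeilRank ↔ Even Curve5077a.E.analyticRank :=
  even_rank_iff_even_analyticRank_of_rank_eq_three _ curve5077a_mordellWeilRank_eq_three
    (Curve5077a.rootNumber_E hmod)

/-- Row `0`: parity, sign form, modulo Modularity alone. [cite: DokchitserDokchitser2010, §1 Conj. 1.1 and Thm. 1.4] -/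
theorem rootNumber_row0_eq_neg_one_pow_rank (hmod : exists_isNewformOf) :
    (rank3Table[0]'(by rw [rank3Table_length]; decide)).curve.rootNumber =
      (-1) ^ (rank3Table[0]'(by rw [rank3Table_length]; decide)).curve.mordellWeilRank := by
  rw [curve_row0_eq]; exact curve5077a_rootNumber_eq_neg_one_pow_rank hmod

/-- Row `0`: parity, order form, modulo Modularity alone. [cite: DokchitserDokchitser2010, §1 Conj. 1.1 and Thm. 1.4] -/
theorem even_rank_row0_iff_even_analyticRank (hmod : exists_isNewformOf) :
    Even (rank3Table[0]'(by rw [rank3Table_length]; decide)).curve.mordellWeilRank ↔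
      Even (rank3Table[0]'(by rw [rank3Table_length]; decide)).curve.analyticRank := by
  rw [curve_row0_eq]; exact curve5077a_even_rank_iff_even_analyticRank hmod

/-! ### §3 Row `0` against the conjecture: `rank_ℤ ≤ ord`, BSD's prediction, and the `L‴` criterion — engine-free -/

/-- `3 = rank_ℤ ≤ ord_{s=1} L(5077a,s)` modulo Modularity + Gross–Zagier–Kolyvagin, no engine-side input
(`Curve5077a.three_le_analyticRank` with the sign from `rootNumber_E`). [cite: GrossZagier1986, (8.2)–(8.3)]
[cite: Darmon2004, Thm. 3.22] -/
theorem curve5077a_mordellWeilRank_le_analyticRank (hmod : exists_isNewformOf)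
    (hGZK : rank_eq_analyticRank_of_analyticRank_le_one) :
    Curve5077a.E.mordellWeilRank ≤ Curve5077a.E.analyticRank := by
  rw [curve5077a_mordellWeilRank_eq_three]
  exact Curve5077a.three_le_analyticRank hGZK (Curve5077a.rootNumber_E hmod)

/-- Row `0`: `rank_ℤ ≤ ord_{s=1} L(E,s)` modulo Modularity + GZK, engine-free. [cite: GrossZagier1986, (8.2)–(8.3)]
[cite: Darmon2004, Thm. 3.22] -/
theorem mordellWeilRank_row0_le_analyticRank (hmod : exists_isNewformOf)
    (hGZK : rank_eq_analyticRank_of_analyticRank_le_one) :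
    (rank3Table[0]'(by rw [rank3Table_length]; decide)).curve.mordellWeilRank ≤
      (rank3Table[0]'(by rw [rank3Table_length]; decide)).curve.analyticRank := by
  rw [curve_row0_eq]; exact curve5077a_mordellWeilRank_le_analyticRank hmod hGZK

/-- **BSD's prediction for `5077a`, engine-free**: the summit statement `BirchSwinnertonDyer` (with
`rank_ℤ = 3` by certificate and `w = −1` by Modularity) gives `L‴(E,1) ≠ 0`. A logical consequence of the
conjecture, not evidence for it. [cite: Wiles2000, p. 2] [cite: BuhlerGrossZagier1985, §4 (14)] -/
theorem curve5077a_iteratedDeriv_three_ne_zero_of_bsd (hBSD : _root_.BirchSwinnertonDyer)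
    (hmod : exists_isNewformOf) : iteratedDeriv 3 Curve5077a.E.entireLFunction 1 ≠ 0 :=
  iteratedDeriv_three_ne_zero_of_bsd _ hBSD curve5077a_mordellWeilRank_eq_three (Curve5077a.rootNumber_E hmod)

/-- Row `0`: BSD's prediction `L‴(E,1) ≠ 0`, engine-free (cf. `Rank3Row.iteratedDeriv_three_ne_zero_of_bsd_of_mem_rows9375`,
whose `hKD`/`hR` are here discharged by Modularity). [cite: Wiles2000, p. 2] [cite: BuhlerGrossZagier1985, §4 (14)] -/
theorem iteratedDeriv_three_ne_zero_row0_of_bsd (hBSD : _root_.BirchSwinnertonDyer)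
    (hmod : exists_isNewformOf) :
    iteratedDeriv 3 (rank3Table[0]'(by rw [rank3Table_length]; decide)).curve.entireLFunction 1 ≠ 0 := by
  rw [curve_row0_eq]; exact curve5077a_iteratedDeriv_three_ne_zero_of_bsd hBSD hmod

/-- **Weak BSD for `5077a` ↔ `L‴(E,1) ≠ 0`**, engine-free: (→) modulo Modularity; (←) modulo Modularity +
Gross–Zagier–Kolyvagin. The right-hand side is itself a theorem of the tree
(`Curve5077aAnalyticRankLeThree.iteratedDeriv_three_entireLFunction_E_ne_zero`, numerics-free), to be
joined here once that module is rebuilt. [cite: BuhlerGrossZagier1985, §4 (14)] [cite: GrossZagier1986, (8.2)–(8.3)] -/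
theorem curve5077a_analyticRank_eq_rank_iff_iteratedDeriv_three_ne_zero (hmod : exists_isNewformOf) :
    (Curve5077a.E.analyticRank = Curve5077a.E.mordellWeilRank →
        iteratedDeriv 3 Curve5077a.E.entireLFunction 1 ≠ 0) ∧
      (rank_eq_analyticRank_of_analyticRank_le_one →
        iteratedDeriv 3 Curve5077a.E.entireLFunction 1 ≠ 0 →
          Curve5077a.E.analyticRank = Curve5077a.E.mordellWeilRank) :=
  analyticRank_eq_rank_iff_iteratedDeriv_three_ne_zero' _ curve5077a_mordellWeilRank_eq_three
    (Curve5077a.rootNumber_E hmod)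

/-- **Weak BSD for `5077a` from `L‴(E,1) ≠ 0`**, modulo Modularity + GZK, engine-free: the exact shape in
which the staged join consumes `Curve5077aAnalyticRankLeThree`. [cite: BuhlerGrossZagier1985, §4 (14)]
[cite: GrossZagier1986, (8.2)–(8.3)] [cite: Darmon2004, Thm. 3.22] -/
theorem curve5077a_analyticRank_eq_rank_of_iteratedDeriv_three_ne_zero (hmod : exists_isNewformOf)
    (hGZK : rank_eq_analyticRank_of_analyticRank_le_one)
    (hL3 : iteratedDeriv 3 Curve5077a.E.entireLFunction 1 ≠ 0) :
    Curve5077a.E.analyticRank = Curve5077a.E.mordellWeilRank :=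
  (curve5077a_analyticRank_eq_rank_iff_iteratedDeriv_three_ne_zero hmod).2 hGZK hL3

/-- Row `0`: weak BSD `ord_{s=1} L(E,s) = rank_ℤ E(ℚ)` from `L‴(E,1) ≠ 0`, modulo Modularity + GZK,
engine-free. [cite: BuhlerGrossZagier1985, §4 (14)] [cite: GrossZagier1986, (8.2)–(8.3)] -/
theorem weakBSD_row0_of_iteratedDeriv_three_ne_zero (hmod : exists_isNewformOf)
    (hGZK : rank_eq_analyticRank_of_analyticRank_le_one)
    (hL3 : iteratedDeriv 3 (rank3Table[0]'(by rw [rank3Table_length]; decide)).curve.entireLFunction 1 ≠ 0) :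
    (rank3Table[0]'(by rw [rank3Table_length]; decide)).curve.analyticRank =
      (rank3Table[0]'(by rw [rank3Table_length]; decide)).curve.mordellWeilRank := by
  rw [curve_row0_eq] at hL3 ⊢
  exact curve5077a_analyticRank_eq_rank_of_iteratedDeriv_three_ne_zero hmod hGZK hL3

/-- **Where a failure at `5077a` would have to sit**: if weak BSD failed for this curve then
`ord_{s=1} L(E,s) ≥ 5` (modulo Modularity + GZK; engine-free) — an «anomaly under verification» could
only be an `L‴(E,1) = 0`, which the tree's numerics-free enclosure excludes. [cite: GrossZagier1986, (8.2)–(8.3)]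
[cite: Darmon2004, Thm. 3.22] -/
theorem curve5077a_five_le_analyticRank_of_ne (hmod : exists_isNewformOf)
    (hGZK : rank_eq_analyticRank_of_analyticRank_le_one)
    (hne : Curve5077a.E.analyticRank ≠ Curve5077a.E.mordellWeilRank) : 5 ≤ Curve5077a.E.analyticRank :=
  five_le_analyticRank_of_analyticRank_ne_rank _ hGZK curve5077a_mordellWeilRank_eq_three
    (Curve5077a.rootNumber_E hmod) hne

/-- **Row `0` summary, engine-free**: `rank_ℤ = 3` (certificate) ∧ `w = −1` (Modularity) ∧
`w = (−1)^{rank_ℤ}` ∧ `3 ≤ ord` (+ GZK) ∧ (weak BSD ↔ `L‴(E,1) ≠ 0`). One curve; no general claim.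
[cite: BuhlerGrossZagier1985, §4 (11), (14)] [cite: GrossZagier1986, (8.2)–(8.3)] [cite: CremonaAlgorithms1997, Tables, §3.5, §3.6] -/
theorem row0_by_name (hmod : exists_isNewformOf) (hGZK : rank_eq_analyticRank_of_analyticRank_le_one) :
    (rank3Table[0]'(by rw [rank3Table_length]; decide)).curve = Curve5077a.E ∧
    Curve5077a.E.mordellWeilRank = 3 ∧ Curve5077a.E.rootNumber = -1 ∧
    Curve5077a.E.rootNumber = (-1) ^ Curve5077a.E.mordellWeilRank ∧
    3 ≤ Curve5077a.E.analyticRank ∧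
    (Curve5077a.E.analyticRank = Curve5077a.E.mordellWeilRank ↔
      iteratedDeriv 3 Curve5077a.E.entireLFunction 1 ≠ 0) :=
  ⟨curve_row0_eq, curve5077a_mordellWeilRank_eq_three, Curve5077a.rootNumber_E hmod,
    curve5077a_rootNumber_eq_neg_one_pow_rank hmod,
    Curve5077a.three_le_analyticRank hGZK (Curve5077a.rootNumber_E hmod),
    ⟨(curve5077a_analyticRank_eq_rank_iff_iteratedDeriv_three_ne_zero hmod).1,
      (curve5077a_analyticRank_eq_rank_iff_iteratedDeriv_three_ne_zero hmod).2 hGZK⟩⟩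

end Summit.BirchSwinnertonDyer.BirchSwinnertonDyer.Rank2Observatory
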